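import Summits.ABC.IUTFork.Joshi.TestThetaValuesLocus
import Summits.ABC.IUTFork.Joshi.ThetaLocusSaturation
import HarnessLib

/-!
# TEST addendum: what the SATURATION `|Θ̃|_B ≥ 1` of Joshi's typed locus does to the volume dictionary `VolumeDictionary`
# (arXiv:2303.01662 v3 vs OUR typed [IUTchIII] Cor. 3.12) — kernel consequences; located, not adjudicated

Test file of the abc-iut cell, branch E (rung LADDER-ABC:A2.E; seat abc-iut-E-t3; E-PLAN R14), sequel of
`Joshi/TestThetaValuesLocus.lean` (p429558: `VolumeDictionary`, `labelSum_qLocal_le_of_volumeDictionary`, `statement_of_labelSum_le`)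
and `Joshi/ThetaLocusSaturation.lean` (`RootTower`, `one_le_size_thetaLocus`). Sources: K. Joshi, arXiv:2303.01662 v3 (bib
`Joshi2023ATS2Local`), UNREFEREED, rejected by the IUT author [Mochizuki2024JoshiReport], accepted by neither side of the dispute
(D-0012). FRAMING: locates / conditionally verifies; no abc claim; no side taken on [IUTchIII] Cor. 3.12 or on any author; typed ≠
proved ≠ endorsed. `S := Cor312Vol.PilotKummerIndRelated` occurs nowhere below.

CONTENT. With the root tower (`F = ℂ_p^♭` algebraically closed; the canonical point of the proof of Thm. 9.2.1) the typed locus has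
`|Θ̃|_B ≥ 1`; the hull-level dictionary `VolumeDictionary` (iii) («`|Θ̃|_B = exp Σ_j logvol(ⁿ˒°𝒰_{j,v_ℚ₀})`», OUR READING of §8.7–§9.3)
therefore FORCES `Σ_j logvol(ⁿ˒°𝒰_{j,v_ℚ₀}) ≥ 0` at the dictionary's place (`hullSum_nonneg_of_volumeDictionary`): it cannot be
instantiated on any setting whose packet hulls at `v_ℚ₀` have negative total log-volume (`not_volumeDictionary_of_hullSum_neg`), and
under a «LogVol ≤ 0» sign convention (as abc-iut-E-t4 reads [J-III] p. 128 l. 9–10 for his `ATS3.LocusDatum.LogVolNonpos`) it pins that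
total to `0` (`hullSum_eq_zero_of_volumeDictionary`). The q-side is untouched: `labelSum_qLocal_le_of_volumeDictionary` still yields
the `v_ℚ₀`-summand of the Statement, now for the trivial reason `Σ_j qLocal = ℓ⋆·log|ξ|_0 ≤ 0 ≤ Σ_j hull-logvol`
(`labelSum_qLocal_nonpos_of_volumeDictionary`). Reported as a LOCATION of where Y_vol = `VolumeDictionary` would have to carry content;
no verdict on print or preprint. [claim: Joshi2023ATS2Local, status: disputed]
-/

noncomputable section

open Set

namespace Summit.ABC.IUTFork.Joshi

open Thm311 Cor312 Cor312Vol Literature.IUT.LogThetaLattice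

variable {F B E0 : Type} [Field F] [CommRing B] [Field E0] {Y : Type} {K : Y → Type} [∀ y, Field (K y)] {G : Type}
  {J : PrototypeDatum F B E0 Y K G} {T : ThetaIndex} {S : Situation T} {P : Cor312.Setting S} {vQ₀ : T.VQ}

/-- **Saturation through the dictionary**: a volume dictionary at `v_ℚ₀` and the root tower force the label-sum of the packet hull
log-volumes at `v_ℚ₀` to be NONNEGATIVE (`1 ≤ |Θ̃|_B = exp Σ_j logvol(ⁿ˒°𝒰_{j,v_ℚ₀})`). [claim: Joshi2023ATS2Local, status: disputed] -/
theorem hullSum_nonneg_of_volumeDictionary (D : VolumeDictionary J P vQ₀) (r : J.RootTower) :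
    0 ≤ ∑ i : Fin T.lstar, (S.D P.n).logvol (Setting.labelSucc i) vQ₀ (P.thetaHull (Setting.labelSucc i) vQ₀) := by
  have h := r.one_le_size_thetaLocus
  rw [D.size_eq, ← EReal.coe_one, EReal.coe_le_coe_iff] at h
  have := Real.log_le_log one_pos h
  rwa [Real.log_one, Real.log_exp] at this

/-- Hence NO volume dictionary at a place whose packet hulls have negative total log-volume (given the root tower) — e.g. honest
`p`-adic hull volumes `Σ_j logvol(B_{e_j}) = −(Σ_j e_j)·log p < 0`. LOCATION, not verdict. [claim: Joshi2023ATS2Local, status: disputed] -/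
theorem not_volumeDictionary_of_hullSum_neg (r : J.RootTower)
    (h : ∑ i : Fin T.lstar, (S.D P.n).logvol (Setting.labelSucc i) vQ₀ (P.thetaHull (Setting.labelSucc i) vQ₀) < 0) :
    ¬ VolumeDictionary J P vQ₀ := fun D => (not_le.2 h) (hullSum_nonneg_of_volumeDictionary D r)

/-- Under a «LogVol ≤ 0» sign convention for the hull volumes at `v_ℚ₀` (cf. abc-iut-E-t4's `ATS3.LocusDatum.LogVolNonpos`, his reading
of [J-III] p. 128 l. 9–10), the dictionary and the root tower pin the total hull log-volume at `v_ℚ₀` to `0`. [claim: Joshi2023ATS2Local, status: disputed] -/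
theorem hullSum_eq_zero_of_volumeDictionary (D : VolumeDictionary J P vQ₀) (r : J.RootTower)
    (hle : ∑ i : Fin T.lstar, (S.D P.n).logvol (Setting.labelSucc i) vQ₀ (P.thetaHull (Setting.labelSucc i) vQ₀) ≤ 0) :
    ∑ i : Fin T.lstar, (S.D P.n).logvol (Setting.labelSucc i) vQ₀ (P.thetaHull (Setting.labelSucc i) vQ₀) = 0 :=
  le_antisymm hle (hullSum_nonneg_of_volumeDictionary D r)

/-- The q-side under the dictionary: `Σ_j qLocal(j, v_ℚ₀) = ℓ⋆·log|ξ|_0 ≤ 0`. [claim: Joshi2023ATS2Local, status: disputed] -/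
theorem labelSum_qLocal_nonpos_of_volumeDictionary (D : VolumeDictionary J P vQ₀) :
    ∑ i : Fin T.lstar, P.qLocal (Setting.labelSucc i) vQ₀ ≤ 0 := by
  rw [Finset.sum_congr rfl fun i _ => D.qLocal_eq i]
  exact Finset.sum_nonpos fun i _ => Real.log_nonpos J.abs0_xi_pos.le J.abs0_xi_lt_one.le

/-- So with the root tower the `v_ℚ₀`-summand of the Statement that `labelSum_qLocal_le_of_volumeDictionary` derives holds for the
TRIVIAL reason `Σ_j qLocal ≤ 0 ≤ Σ_j hull-logvol` — the dictionary's content sits entirely in (iii). [claim: Joshi2023ATS2Local, status: disputed] -/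
theorem labelSum_qLocal_le_of_volumeDictionary_trivially (D : VolumeDictionary J P vQ₀) (r : J.RootTower) :
    ∑ i : Fin T.lstar, P.qLocal (Setting.labelSucc i) vQ₀ ≤
      ∑ i : Fin T.lstar, (S.D P.n).logvol (Setting.labelSucc i) vQ₀ (P.thetaHull (Setting.labelSucc i) vQ₀) :=
  (labelSum_qLocal_nonpos_of_volumeDictionary D).trans (hullSum_nonneg_of_volumeDictionary D r)

end Summit.ABC.IUTFork.Joshi

end
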